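import Summits.RiemannHypothesis.RiemannHypothesis.Theorems.GroundBartaEvenWinsBeyondArchDeflationWindowImageSplit
import Literature.Analysis.ValidatedNumerics.TaylorModelExp
import Literature.Analysis.ValidatedNumerics.TaylorModelQuadrature
import Literature.Analysis.ValidatedNumerics.ExpPoly.SecondDifference
import HarnessLib

/-!
# RiemannHypothesis / GroundBarta — rung 4 (`EvenWinsBeyondArch`, stmt-RiemannHypothesis-18807 / 18085):
# the deflated Temple L-side, XVII a — pole, prime and polynomial terms of the window image as per-panel Taylor models

Helper file (`--supports stmt-RiemannHypothesis-18807`), RH-free, Mathlib + landed tree files only, no facts.  Prover B,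
speedrun unit `sr-gb-rung-b` (gen 4).

Kernel-computable Taylor models, in the panel variable `ρ = y − y₀`, of the elementary terms of the real window image
(`dt_windowImage_real`, file XIV) of a windowed polynomial `𝟙_{[-c,c]}·g`, `g = Poly.eval gp`:
* POLE COEFFICIENTS `P_c = ∫_{-c}^{c} g cosh(x/2)`, `P_s = ∫_{-c}^{c} g sinh(x/2)` as intervals (`dt_poleCoshI`, `dt_poleSinhI`,
  `dt_mem_poleCoshI/SinhI`): exact antiderivatives `Poly.ad (±½)` (ExpPoly) + enclosures `E⁺ ∋ e^{c/2}`, `E⁻ ∋ e^{-c/2}` (inputs);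
* POLE TERM `2P_c cosh(y/2) − 2P_s sinh(y/2) = (P_c − P_s)e^{y/2} + (P_c + P_s)e^{-y/2}` (`dt_poleTM`, `dt_tmem_poleTM`): `texpI` for
  `e^{±ρ/2}` + enclosures of `e^{±y₀/2}` (inputs);
* PRIME TERM `w·(2g(y) − ĝ(y − L) − ĝ(y + L))` for one prime power (`w = Λ(n)n^{-1/2}`, `L = log n`, both enclosed inputs) on a panel
  where the window membership of `y ∓ L` is CONSTANT (flags `inL`, `inR` with semantic hypotheses) (`dt_primeTermTM`,
  `dt_tmem_primeTermTM`): exact `2g(y₀+ρ)` + `thornerI` compositions `g((y₀ ∓ L) + ρ)`;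
* POLYNOMIAL TERM `p(y₀ + ρ)` for an exact rational `p` (`−M̃ g − Σ_l W̃_il g_l`, assembled by the generator) (`dt_polyTM`).
All transcendental constants enter as `MI` inputs with `MI.mem` hypotheses (discharged by the certificate from the enclosure
libraries), so the file is independent of how they are produced.  The archimedean terms are files XVI (`dt_archSplitTM`) and
`Literature/…/WeilArchTailPanels` (`weilArchTailTM`).

References: E. Bombieri, Rend. Mat. Acc. Lincei (9) 11 (2000) Thm 2 [Bombieri2000Weil]; K. Makino, M. Berz (2003).
-/

set_option linter.dupNamespace false

noncomputable section

open MeasureTheory Set Filter intervalIntegral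
open scoped Topology BigOperators Interval

namespace Summit.RiemannHypothesis.RiemannHypothesis.Theorems.EvenWinsBeyondArch

open Literature.NumberTheory.LFunctions
open Literature.Analysis.ValidatedNumerics Literature.Analysis.ValidatedNumerics.PolyMP
  Literature.Analysis.ValidatedNumerics.NumericsMP Literature.Analysis.ValidatedNumerics.ExpPoly

/-! ## Exact exponential moments of a polynomial -/

/-- `∫_a^b g(x) e^{κx} dx = A(b)e^{κb} − A(a)e^{κa}`, `A = Poly.ad κ g` (exact rational antiderivative). [folklore] -/
theorem dt_integral_poly_mul_exp (gp : Poly) (κ : ℚ) (a b : ℝ) :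
    ∫ x in a..b, Poly.eval gp x * Real.exp ((κ : ℝ) * x) =
      Poly.eval (Poly.ad κ gp) b * Real.exp ((κ : ℝ) * b) - Poly.eval (Poly.ad κ gp) a * Real.exp ((κ : ℝ) * a) := by
  have hd : ∀ x ∈ uIcc a b, HasDerivAt (fun y ↦ Poly.eval (Poly.ad κ gp) y * Real.exp ((κ : ℝ) * y))
      (Poly.eval gp x * Real.exp ((κ : ℝ) * x)) x := by
    intro x _
    have h := Poly.hasDerivAt_ad κ 0 gp x
    simp only [Rat.cast_zero, add_zero] at h
    exact h
  rw [integral_eq_sub_of_hasDerivAt hd (by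
    apply Continuous.intervalIntegrable; exact (Poly.continuous_eval gp).mul (by fun_prop))]

/-! ## The pole coefficients as intervals -/

/-- `I⁺ = ∫_{-c}^{c} g e^{x/2}` from `E⁺ ∋ e^{c/2}`, `E⁻ ∋ e^{-c/2}`. -/
def dt_expPlusI (S : ℕ) (gp : Poly) (c : ℚ) (Ep Em : MI) : MI :=
  MI.sub (MI.mul S (ofRat S (Poly.evalQ (Poly.ad (1 / 2) gp) c)) Ep)
    (MI.mul S (ofRat S (Poly.evalQ (Poly.ad (1 / 2) gp) (-c))) Em)

/-- `I⁻ = ∫_{-c}^{c} g e^{-x/2}`. -/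
def dt_expMinusI (S : ℕ) (gp : Poly) (c : ℚ) (Ep Em : MI) : MI :=
  MI.sub (MI.mul S (ofRat S (Poly.evalQ (Poly.ad (-(1 / 2)) gp) c)) Em)
    (MI.mul S (ofRat S (Poly.evalQ (Poly.ad (-(1 / 2)) gp) (-c))) Ep)

/-- `P_c = ∫_{-c}^{c} g cosh(x/2) = ½(I⁺ + I⁻)` as an interval. -/
def dt_poleCoshI (S : ℕ) (gp : Poly) (c : ℚ) (Ep Em : MI) : MI :=
  MI.divNat (MI.add (dt_expPlusI S gp c Ep Em) (dt_expMinusI S gp c Ep Em)) 2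

/-- `P_s = ∫_{-c}^{c} g sinh(x/2) = ½(I⁺ − I⁻)` as an interval. -/
def dt_poleSinhI (S : ℕ) (gp : Poly) (c : ℚ) (Ep Em : MI) : MI :=
  MI.divNat (MI.sub (dt_expPlusI S gp c Ep Em) (dt_expMinusI S gp c Ep Em)) 2

/-- [folklore] -/
theorem dt_mem_expPlusI {S : ℕ} (hS : 0 < S) (gp : Poly) (c : ℚ) {Ep Em : MI}
    (hEp : MI.mem S (Real.exp ((c : ℝ) / 2)) Ep) (hEm : MI.mem S (Real.exp (-((c : ℝ) / 2))) Em) :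
    MI.mem S (∫ x in (-(c : ℝ))..c, Poly.eval gp x * Real.exp (x / 2)) (dt_expPlusI S gp c Ep Em) := by
  have h := dt_integral_poly_mul_exp gp (1 / 2) (-(c : ℝ)) c
  have e : (fun x : ℝ ↦ Poly.eval gp x * Real.exp (x / 2)) = fun x ↦ Poly.eval gp x * Real.exp (((1 / 2 : ℚ) : ℝ) * x) := by
    funext x; congr 2; push_cast; ring
  rw [e, h]
  have e1 : Real.exp ((((1 / 2 : ℚ)) : ℝ) * c) = Real.exp ((c : ℝ) / 2) := by congr 1; push_cast; ring
  have e2 : Real.exp ((((1 / 2 : ℚ)) : ℝ) * -(c : ℝ)) = Real.exp (-((c : ℝ) / 2)) := by congr 1; push_cast; ring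
  rw [e1, e2]
  refine MI.mem_sub (MI.mem_mul hS ?_ hEp) (MI.mem_mul hS ?_ hEm)
  · have := mem_ofRat S (Poly.evalQ (Poly.ad (1 / 2) gp) c); rwa [Poly.eval_evalQ] at this
  · have := mem_ofRat S (Poly.evalQ (Poly.ad (1 / 2) gp) (-c)); rwa [Poly.eval_evalQ, Rat.cast_neg] at this

/-- [folklore] -/
theorem dt_mem_expMinusI {S : ℕ} (hS : 0 < S) (gp : Poly) (c : ℚ) {Ep Em : MI}
    (hEp : MI.mem S (Real.exp ((c : ℝ) / 2)) Ep) (hEm : MI.mem S (Real.exp (-((c : ℝ) / 2))) Em) :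
    MI.mem S (∫ x in (-(c : ℝ))..c, Poly.eval gp x * Real.exp (-(x / 2))) (dt_expMinusI S gp c Ep Em) := by
  have h := dt_integral_poly_mul_exp gp (-(1 / 2)) (-(c : ℝ)) c
  have e : (fun x : ℝ ↦ Poly.eval gp x * Real.exp (-(x / 2))) =
      fun x ↦ Poly.eval gp x * Real.exp (((-(1 / 2) : ℚ) : ℝ) * x) := by
    funext x; congr 2; push_cast; ring
  rw [e, h]
  have e1 : Real.exp ((((-(1 / 2) : ℚ)) : ℝ) * c) = Real.exp (-((c : ℝ) / 2)) := by congr 1; push_cast; ring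
  have e2 : Real.exp ((((-(1 / 2) : ℚ)) : ℝ) * -(c : ℝ)) = Real.exp ((c : ℝ) / 2) := by congr 1; push_cast; ring
  rw [e1, e2]
  refine MI.mem_sub (MI.mem_mul hS ?_ hEm) (MI.mem_mul hS ?_ hEp)
  · have := mem_ofRat S (Poly.evalQ (Poly.ad (-(1 / 2)) gp) c); rwa [Poly.eval_evalQ] at this
  · have := mem_ofRat S (Poly.evalQ (Poly.ad (-(1 / 2)) gp) (-c)); rwa [Poly.eval_evalQ, Rat.cast_neg] at this

/-- **`P_c ∈ dt_poleCoshI`.** [folklore] -/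
theorem dt_mem_poleCoshI {S : ℕ} (hS : 0 < S) (gp : Poly) (c : ℚ) {Ep Em : MI}
    (hEp : MI.mem S (Real.exp ((c : ℝ) / 2)) Ep) (hEm : MI.mem S (Real.exp (-((c : ℝ) / 2))) Em) :
    MI.mem S (∫ x in (-(c : ℝ))..c, Poly.eval gp x * Real.cosh (x / 2)) (dt_poleCoshI S gp c Ep Em) := by
  have hI : ∀ x : ℝ, Poly.eval gp x * Real.cosh (x / 2) =
      (Poly.eval gp x * Real.exp (x / 2) + Poly.eval gp x * Real.exp (-(x / 2))) / 2 := fun x ↦ by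
    rw [Real.cosh_eq]; ring
  simp_rw [hI]
  have hf : IntervalIntegrable (fun x : ℝ ↦ Poly.eval gp x * Real.exp (x / 2)) volume (-(c : ℝ)) c :=
    ((Poly.continuous_eval gp).mul (by fun_prop)).intervalIntegrable _ _
  have hg : IntervalIntegrable (fun x : ℝ ↦ Poly.eval gp x * Real.exp (-(x / 2))) volume (-(c : ℝ)) c :=
    ((Poly.continuous_eval gp).mul (by fun_prop)).intervalIntegrable _ _
  rw [intervalIntegral.integral_div, intervalIntegral.integral_add (f := fun x : ℝ ↦ Poly.eval gp x * Real.exp (x / 2))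
    (g := fun x : ℝ ↦ Poly.eval gp x * Real.exp (-(x / 2))) hf hg]
  exact MI.mem_divNat (MI.mem_add (dt_mem_expPlusI hS gp c hEp hEm) (dt_mem_expMinusI hS gp c hEp hEm)) two_pos

/-- **`P_s ∈ dt_poleSinhI`.** [folklore] -/
theorem dt_mem_poleSinhI {S : ℕ} (hS : 0 < S) (gp : Poly) (c : ℚ) {Ep Em : MI}
    (hEp : MI.mem S (Real.exp ((c : ℝ) / 2)) Ep) (hEm : MI.mem S (Real.exp (-((c : ℝ) / 2))) Em) :
    MI.mem S (∫ x in (-(c : ℝ))..c, Poly.eval gp x * Real.sinh (x / 2)) (dt_poleSinhI S gp c Ep Em) := by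
  have hI : ∀ x : ℝ, Poly.eval gp x * Real.sinh (x / 2) =
      (Poly.eval gp x * Real.exp (x / 2) - Poly.eval gp x * Real.exp (-(x / 2))) / 2 := fun x ↦ by
    rw [Real.sinh_eq]; ring
  simp_rw [hI]
  have hf : IntervalIntegrable (fun x : ℝ ↦ Poly.eval gp x * Real.exp (x / 2)) volume (-(c : ℝ)) c :=
    ((Poly.continuous_eval gp).mul (by fun_prop)).intervalIntegrable _ _
  have hg : IntervalIntegrable (fun x : ℝ ↦ Poly.eval gp x * Real.exp (-(x / 2))) volume (-(c : ℝ)) c :=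
    ((Poly.continuous_eval gp).mul (by fun_prop)).intervalIntegrable _ _
  rw [intervalIntegral.integral_div, intervalIntegral.integral_sub (f := fun x : ℝ ↦ Poly.eval gp x * Real.exp (x / 2))
    (g := fun x : ℝ ↦ Poly.eval gp x * Real.exp (-(x / 2))) hf hg]
  exact MI.mem_divNat (MI.mem_sub (dt_mem_expPlusI hS gp c hEp hEm) (dt_mem_expMinusI hS gp c hEp hEm)) two_pos

/-! ## The pole term as a Taylor model -/

/-- Taylor model of `ρ ↦ 2P_c cosh((y₀+ρ)/2) − 2P_s sinh((y₀+ρ)/2) = (P_c−P_s)e^{y₀/2}e^{ρ/2} + (P_c+P_s)e^{-y₀/2}e^{-ρ/2}`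
from intervals `Pc ∋ P_c`, `Ps ∋ P_s`, `Eyp ∋ e^{y₀/2}`, `Eym ∋ e^{-y₀/2}` (exponential series order `K`). -/
def dt_poleTM (S : ℕ) (h : ℚ) (K : ℕ) (Pc Ps Eyp Eym : MI) : IPoly :=
  taddI (tsmulI S (MI.mul S (MI.sub Pc Ps) Eyp) (texpI S h K (1 / 2)))
    (tsmulI S (MI.mul S (MI.add Pc Ps) Eym) (texpI S h K (-(1 / 2))))

/-- **The pole term, enclosed.** [cite: Bombieri2000Weil, Thm 2 (pole term)] -/
theorem dt_tmem_poleTM {S : ℕ} (hS : 0 < S) {h : ℚ} (hh : 0 ≤ h) (hh2 : h ≤ 2) {K : ℕ} (hK : 0 < K)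
    {Pc Ps Eyp Eym : MI} {pc ps y0 : ℝ} (hPc : MI.mem S pc Pc) (hPs : MI.mem S ps Ps)
    (hEyp : MI.mem S (Real.exp (y0 / 2)) Eyp) (hEym : MI.mem S (Real.exp (-(y0 / 2))) Eym) :
    TMem S h (fun ρ ↦ 2 * pc * Real.cosh ((y0 + ρ) / 2) - 2 * ps * Real.sinh ((y0 + ρ) / 2))
      (dt_poleTM S h K Pc Ps Eyp Eym) := by
  have hq1 : |(1 / 2 : ℚ) * h| ≤ 1 := by rw [abs_le]; constructor <;> linarith
  have hq2 : |(-(1 / 2) : ℚ) * h| ≤ 1 := by rw [abs_le]; constructor <;> linarith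
  have h1 := tmem_smulI hS (h := h) (MI.mem_mul hS (MI.mem_sub hPc hPs) hEyp) (tmem_exp (S := S) hK hq1)
  have h2 := tmem_smulI hS (h := h) (MI.mem_mul hS (MI.mem_add hPc hPs) hEym) (tmem_exp (S := S) hK hq2)
  intro ρ hρ
  obtain ⟨as, has, e⟩ := tmem_add h1 h2 ρ hρ
  refine ⟨as, has, ?_⟩
  rw [← e]
  beta_reduce
  rw [Real.cosh_eq, Real.sinh_eq]
  have e1 : Real.exp ((y0 + ρ) / 2) = Real.exp (y0 / 2) * Real.exp (((1 / 2 : ℚ) : ℝ) * ρ) := by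
    rw [← Real.exp_add]; congr 1; push_cast; ring
  have e2 : Real.exp (-((y0 + ρ) / 2)) = Real.exp (-(y0 / 2)) * Real.exp (((-(1 / 2) : ℚ) : ℝ) * ρ) := by
    rw [← Real.exp_add]; congr 1; push_cast; ring
  rw [e1, e2]
  ring

/-! ## The prime terms as Taylor models -/

/-- The zero Taylor model. -/
theorem dt_tmem_nil {S : ℕ} {h : ℚ} : TMem S h (fun _ ↦ (0 : ℝ)) ([] : IPoly) :=
  fun _ _ ↦ ⟨[], pmem_nil S, by simp⟩

/-- Taylor model of `ρ ↦ w·(2g(y₀+ρ) − [inL] g(y₀+ρ−L) − [inR] g(y₀+ρ+L))` from `W ∋ w`, `Ln ∋ L` (composition order `D`). -/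
def dt_primeTermTM (S : ℕ) (h : ℚ) (D : ℕ) (gp : Poly) (y0 : ℚ) (W Ln : MI) (inL inR : Bool) : IPoly :=
  let g0 : IPoly := tsmulInt 2 (ratPolyI S (Poly.taylorShift gp y0))
  let gl : IPoly := if inL then thornerI S h D gp (tvar S (MI.sub (ofRat S y0) Ln)) else []
  let gr : IPoly := if inR then thornerI S h D gp (tvar S (MI.add (ofRat S y0) Ln)) else []
  tsmulI S W (tsubI (tsubI g0 gl) gr)

/-- **One prime term, enclosed**, on a panel where the window membership of `y ∓ log n` is constant: `ĝ = 𝟙_{[-c,c]}·g`,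
`hinL`/`hninL` (`hinR`/`hninR`) say that `y₀ + ρ − L` (`+ L`) lies in (resp. outside) the window for all `|ρ| ≤ h`.
[cite: Bombieri2000Weil, Thm 2 (prime term)] -/
theorem dt_tmem_primeTermTM {S : ℕ} (hS : 0 < S) {h : ℚ} (hh : 0 ≤ h) (D : ℕ) (gp : Poly) (y0 : ℚ) {c : ℝ}
    {W Ln : MI} {w L : ℝ} (hW : MI.mem S w W) (hLn : MI.mem S L Ln) (inL inR : Bool)
    (hinL : inL = true → ∀ ρ : ℝ, |ρ| ≤ h → (y0 : ℝ) + ρ - L ∈ Icc (-c) c)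
    (hninL : inL = false → ∀ ρ : ℝ, |ρ| ≤ h → (y0 : ℝ) + ρ - L ∉ Icc (-c) c)
    (hinR : inR = true → ∀ ρ : ℝ, |ρ| ≤ h → (y0 : ℝ) + ρ + L ∈ Icc (-c) c)
    (hninR : inR = false → ∀ ρ : ℝ, |ρ| ≤ h → (y0 : ℝ) + ρ + L ∉ Icc (-c) c) :
    TMem S h (fun ρ ↦ w * (2 * Poly.eval gp ((y0 : ℝ) + ρ) -
        (Icc (-c) c).indicator (fun x ↦ Poly.eval gp x) ((y0 : ℝ) + ρ - L) -
        (Icc (-c) c).indicator (fun x ↦ Poly.eval gp x) ((y0 : ℝ) + ρ + L)))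
      (dt_primeTermTM S h D gp y0 W Ln inL inR) := by
  -- the three pieces
  have hg0 : TMem S h (fun ρ ↦ ((2 : ℤ) : ℝ) * Poly.eval gp ((y0 : ℝ) + ρ)) (tsmulInt 2 (ratPolyI S (Poly.taylorShift gp y0))) := by
    have := tmem_smulInt 2 (tmem_ratPoly S h (Poly.taylorShift gp y0))
    refine fun ρ hρ ↦ ?_
    obtain ⟨as, has, e⟩ := this ρ hρ
    exact ⟨as, has, by rw [← e]; beta_reduce; rw [Poly.eval_taylorShift]⟩
  have hgl : TMem S h (fun ρ ↦ (Icc (-c) c).indicator (fun x ↦ Poly.eval gp x) ((y0 : ℝ) + ρ - L))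
      (if inL then thornerI S h D gp (tvar S (MI.sub (ofRat S y0) Ln)) else []) := by
    cases hb : inL with
    | true =>
        have hu : TMem S h (fun ρ ↦ ((y0 : ℝ) - L) + ρ) (tvar S (MI.sub (ofRat S y0) Ln)) :=
          tmem_var (MI.mem_sub (mem_ofRat S y0) hLn)
        have hc := tmem_horner hS hh D hu gp
        intro ρ hρ
        obtain ⟨as, has, e⟩ := hc ρ hρ
        refine ⟨as, by simpa using has, ?_⟩
        rw [← e]; beta_reduce
        rw [indicator_of_mem (hinL hb ρ hρ)]
        ring_nf
    | false =>
        intro ρ hρ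
        refine ⟨[], by simpa using pmem_nil S, ?_⟩
        beta_reduce
        rw [indicator_of_notMem (hninL hb ρ hρ)]
        simp
  have hgr : TMem S h (fun ρ ↦ (Icc (-c) c).indicator (fun x ↦ Poly.eval gp x) ((y0 : ℝ) + ρ + L))
      (if inR then thornerI S h D gp (tvar S (MI.add (ofRat S y0) Ln)) else []) := by
    cases hb : inR with
    | true =>
        have hu : TMem S h (fun ρ ↦ ((y0 : ℝ) + L) + ρ) (tvar S (MI.add (ofRat S y0) Ln)) :=
          tmem_var (MI.mem_add (mem_ofRat S y0) hLn)
        have hc := tmem_horner hS hh D hu gp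
        intro ρ hρ
        obtain ⟨as, has, e⟩ := hc ρ hρ
        refine ⟨as, by simpa using has, ?_⟩
        rw [← e]; beta_reduce
        rw [indicator_of_mem (hinR hb ρ hρ)]
        ring_nf
    | false =>
        intro ρ hρ
        refine ⟨[], by simpa using pmem_nil S, ?_⟩
        beta_reduce
        rw [indicator_of_notMem (hninR hb ρ hρ)]
        simp
  have hall := tmem_smulI hS (h := h) hW (tmem_sub (tmem_sub hg0 hgl) hgr)
  intro ρ hρ
  obtain ⟨as, has, e⟩ := hall ρ hρ
  refine ⟨as, has, ?_⟩
  rw [← e]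
  push_cast
  ring

/-! ## Exact polynomial terms -/

/-- Taylor model (exact) of `ρ ↦ p(y₀ + ρ)`. -/
def dt_polyTM (S : ℕ) (p : Poly) (y0 : ℚ) : IPoly := ratPolyI S (Poly.taylorShift p y0)

/-- [folklore] -/
theorem dt_tmem_polyTM (S : ℕ) (h : ℚ) (p : Poly) (y0 : ℚ) :
    TMem S h (fun ρ ↦ Poly.eval p ((y0 : ℝ) + ρ)) (dt_polyTM S p y0) := by
  intro ρ hρ
  obtain ⟨as, has, e⟩ := tmem_ratPoly S h (Poly.taylorShift p y0) ρ hρ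
  exact ⟨as, has, by rw [← e]; beta_reduce; rw [Poly.eval_taylorShift]⟩

end Summit.RiemannHypothesis.RiemannHypothesis.Theorems.EvenWinsBeyondArch

end
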